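import Summits.AtomisticToContinuum.Crystallization.Theorems.PalmUnimodularRigidityBenjaminiSchrammLimit
import Summits.AtomisticToContinuum.Crystallization.Theorems.SlackRigidity.Negative.WitnessBasics
import Mathlib.MeasureTheory.Measure.Prokhorov
import Mathlib.MeasureTheory.Measure.Portmanteau
import Mathlib.MeasureTheory.Measure.LevyProkhorovMetric
import Mathlib.Probability.Kernel.Composition.MeasureCompProd
import HarnessLib

/-!
# Crux `SlackRigidity` (stmt-AtomisticToContinuum-11960), line `ekeland-surgery-parity`:
# the Benjamini–Schramm limit of a separated family, WITH SUPPORT (stub `stub_hardCoreBSLimit`)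

The registered stub `stub_hardCoreBSLimit` of the lead-c6 skeleton = the planner's `HardCoreBSLimit`
(with the nonemptiness hypothesis `1 ≤ n k` of the landed lemma): along an arbitrary `δ`-separated
family of nonempty finite configurations `x k : Fin (n k) → ℝ³` there are a subsequence `φ` and a
probability law `P` on `Measure ℝ³` which is (i) a.s. rooted `δ`-hard-core, (ii) point-stationary,
(iii) a.s. a LOCAL LIMIT OF ROOTED STAGES — along a further subsequence `ψ` and roots `i k` the
recentred configurations `x (φ (ψ k)) − x (φ (ψ k)) (i k)` are eventually `(R, ε)`-matched with
`atoms μ` for every `R`, `ε > 0` —, (iv) has mean root energy `lim_j 𝓔(x (φ j))/n (φ j)`, and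
(v) receives the uniformly re-rooted `x (φ j)` in the density-transfer (portmanteau) form.

Clauses (i), (ii), (iv), (v) are the landed `EkelandSurgeryParityBSLimit.exists_limit_separated`
(p109188); its proof is re-run here verbatim (the weak limit `Q` of the empirical rooted laws on the
compact metric space `RootedHardCoreConfig ℝ³ δ` is needed by name for the new clause).  The SUPPORT
clause (iii): the support of a weak limit is contained in the Kuratowski upper limit of the supports —
if `S` is not a subsequential limit of stage points, some basic open neighbourhood `U ∋ S` (from a
countable basis) eventually contains no stage point, so `emp_j(U) = 0` eventually and
`Q(U) ≤ liminf_j emp_j(U) = 0` (portmanteau, open sets); countably many such `U` cover the bad set.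
For a subsequential limit, convergence in the local rubber topology is eventual `(R, ε)`-matching
(`LocalConfig.tendsto_iff_locallyMatches`).  All `[folklore]`.
-/

noncomputable section

namespace Summit.AtomisticToContinuum.Crystallization.Theorems.EkelandBSLimitSupported

open Summit.AtomisticToContinuum.Crystallization.Theorems.SlackRigidityNegative (E3)
open MeasureTheory Set Filter Metric TopologicalSpace ProbabilityTheory
open scoped Topology ENNReal NNReal Classical BoundedContinuousFunction
open Literature.Probability.Process Literature.Probability.Process.LocalConfig
open Literature.MathematicalPhysics.StatisticalMechanics
open Summit.AtomisticToContinuum.Crystallization.Theorems.BenjaminiSchrammLimit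

variable {δ : ℝ}

/-- **The Benjamini–Schramm limit along a `δ`-separated family, with support** (`δ > 0` fixed,
nonempty configurations `x k : Fin (n k) → ℝ³`): the uniformly rooted empirical laws on the compact
metric space of rooted `δ`-hard-core configurations have a weakly convergent subsequence (Prokhorov);
exact finite mass transport passes to the limit; the root energy is a continuous local functional and
`E_{P_k}[h] = 𝓔(x k) / n k` exactly; open matching events pass to the limit by the portmanteau
theorem; the limit law is pushed to `Measure (Measure ℝ³)` along the measurable embedding
`S ↦ count|S`; and — the new clause — almost every sample is a local limit of rooted stages (the
support of the weak limit lies in the Kuratowski upper limit of the finite supports). [folklore] -/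
theorem exists_limit_separated_supported [Fact (0 < δ)] {n : ℕ → ℕ} [∀ k, NeZero (n k)]
    (x : (k : ℕ) → (Fin (n k) → E3))
    (hsepx : ∀ (k : ℕ) (i j : Fin (n k)), i ≠ j → δ ≤ dist (x k i) (x k j)) :
    ∃ φ : ℕ → ℕ, StrictMono φ ∧ ∃ P : Measure (Measure E3),
      IsProbabilityMeasure P ∧ (∀ᵐ μ ∂P, IsRootedHardCore δ μ) ∧ IsPointStationaryLaw P ∧
      (∀ᵐ μ ∂P, ∃ ψ : ℕ → ℕ, StrictMono ψ ∧ ∃ i : (k : ℕ) → Fin (n (φ (ψ k))),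
        ∀ R ε : ℝ, 0 < ε → ∀ᶠ k : ℕ in atTop,
          LocallyMatches R ε
            (Set.range fun j : Fin (n (φ (ψ k))) => x (φ (ψ k)) j - x (φ (ψ k)) (i k)) (atoms μ)) ∧
      Tendsto (fun j : ℕ => interactionEnergy lennardJones (x (φ j)) / (n (φ j) : ℝ)) atTop
        (𝓝 (∫ μ, rootEnergy lennardJones μ ∂P)) ∧
      ∀ (T : Set (Measure E3)) (R' ε : ℝ), 0 < ε → ∀ ρ : ℝ, ρ < (P T).toReal →
        ∀ᶠ j : ℕ in atTop, ρ * (n (φ j) : ℝ) ≤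
          (Nat.card {i : Fin (n (φ j)) // ∃ ν ∈ T,
            LocallyMatches R' ε (Set.range fun k : Fin (n (φ j)) => x (φ j) k - x (φ j) i)
              (atoms ν)} : ℝ) := by
  have hδ : 0 < δ := Fact.out
  -- distinct points, from separation
  have hinj : ∀ k, Function.Injective (x k) := fun k i j hij => by
    by_contra hne
    have h := hsepx k i j hne
    rw [hij, dist_self] at h
    exact absurd h (not_le.2 hδ)
  -- the empirical rooted laws on the compact metric space of rooted `δ`-hard-core configurations
  have hprob : ∀ k : ℕ, IsProbabilityMeasure (((n k : ℕ) : ℝ≥0∞)⁻¹ • ∑ i : Fin (n k), (Measure.dirac (RootedHardCoreConfig.ofFinite (x k) (hsepx k) i) :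
      Measure (RootedHardCoreConfig E3 δ))) := fun k =>
    isProbabilityMeasure_emp
  set Qs : ℕ → ProbabilityMeasure (RootedHardCoreConfig E3 δ) := fun k =>
    ⟨(((n k : ℕ) : ℝ≥0∞)⁻¹ • ∑ i : Fin (n k), (Measure.dirac (RootedHardCoreConfig.ofFinite (x k) (hsepx k) i) :
      Measure (RootedHardCoreConfig E3 δ))), hprob k⟩ with hQs_def
  -- Prokhorov: a weakly convergent subsequence
  obtain ⟨Q, ψ, hψ, hlim⟩ := CompactSpace.tendsto_subseq Qs
  set e : RootedHardCoreConfig E3 δ → Measure E3 := fun S => (S.1 : LocalConfig E3).toMeasure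
    with he_def
  have hE : MeasurableEmbedding e := measurableEmbedding_toMeasure E3
  haveI := isSFiniteKernel_toMeasure (E := E3) (δ := δ)
  have hinvN : ∀ m, ((Qs (ψ m) : Measure (RootedHardCoreConfig E3 δ)) ⊗ₘ (⟨fun S : RootedHardCoreConfig E3 δ => (S.1 : LocalConfig E3).toMeasure,
      measurable_toMeasure (Fact.out : 0 < δ)⟩ : Kernel (RootedHardCoreConfig E3 δ) E3)).map (fun p : RootedHardCoreConfig E3 δ × E3 =>
      ((if h : p.2 ∈ ((p.1.1 : LocalConfig E3) : Set E3) then p.1.reroot p.2 h else p.1 :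
        RootedHardCoreConfig E3 δ), -p.2)) =
      (Qs (ψ m) : Measure (RootedHardCoreConfig E3 δ)) ⊗ₘ (⟨fun S : RootedHardCoreConfig E3 δ => (S.1 : LocalConfig E3).toMeasure,
      measurable_toMeasure (Fact.out : 0 < δ)⟩ : Kernel (RootedHardCoreConfig E3 δ) E3) := fun m =>
    map_reroot_compProd_emp (hinj _)
  have hinv := map_reroot_compProd_eq_of_tendsto hlim hinvN
  refine ⟨ψ, hψ, (Q : Measure (RootedHardCoreConfig E3 δ)).map e,
    Measure.isProbabilityMeasure_map hE.measurable.aemeasurable, ?_, ?_, ?_, ?_, ?_⟩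
  · -- almost surely a rooted `δ`-hard-core counting measure
    exact (hE.ae_map_iff).2 (Eventually.of_forall fun S =>
      (isRootedHardCore_toMeasure_iff δ S.1).2 S.2)
  · -- point-stationarity
    exact isPointStationaryLaw_map_toMeasure hinv
  · -- SUPPORT: almost surely a local limit of rooted stages
    rw [hE.ae_map_iff]
    -- (a) a subsequential limit of stage points is a local limit of rooted stages
    have key : ∀ S : RootedHardCoreConfig E3 δ,
        (∀ m : ℕ, ∃ᶠ j in atTop, ∃ i : Fin (n (ψ j)),
          dist (RootedHardCoreConfig.ofFinite (x (ψ j)) (hsepx (ψ j)) i) S < 1 / ((m : ℝ) + 1)) →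
        ∃ ψ' : ℕ → ℕ, StrictMono ψ' ∧ ∃ i : (k : ℕ) → Fin (n (ψ (ψ' k))),
          ∀ R ε : ℝ, 0 < ε → ∀ᶠ k : ℕ in atTop,
            LocallyMatches R ε
              (Set.range fun j : Fin (n (ψ (ψ' k))) => x (ψ (ψ' k)) j - x (ψ (ψ' k)) (i k))
              (atoms (e S)) := by
      intro S hS
      obtain ⟨ψ', hψ', hP⟩ := extraction_forall_of_frequently hS
      choose i hi using hP
      refine ⟨ψ', hψ', i, fun R ε hε => ?_⟩
      have h1 : Tendsto (fun k => RootedHardCoreConfig.ofFinite (x (ψ (ψ' k))) (hsepx _) (i k))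
          atTop (𝓝 S) := by
        rw [tendsto_iff_dist_tendsto_zero]
        refine squeeze_zero (fun k => dist_nonneg) (fun k => (hi k).le) ?_
        exact tendsto_one_div_add_atTop_nhds_zero_nat
      have hconv : Tendsto (fun k => ((RootedHardCoreConfig.ofFinite (x (ψ (ψ' k))) (hsepx _)
          (i k)).1 : LocalConfig E3)) atTop (𝓝 S.1) :=
        (continuous_subtype_val.tendsto S).comp h1
      filter_upwards [(tendsto_iff_locallyMatches.1 hconv) R ε hε] with k hk
      rw [he_def]
      dsimp only
      rw [atoms_toMeasure]
      exact hk.symm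
    -- (b) the other samples form a `Q`-null set
    have hnull : (Q : Measure (RootedHardCoreConfig E3 δ))
        {S | ¬ ∀ m : ℕ, ∃ᶠ j in atTop, ∃ i : Fin (n (ψ j)),
          dist (RootedHardCoreConfig.ofFinite (x (ψ j)) (hsepx (ψ j)) i) S < 1 / ((m : ℝ) + 1)} = 0 := by
      obtain ⟨B, hBc, -, hB⟩ := TopologicalSpace.exists_countable_basis (RootedHardCoreConfig E3 δ)
      -- the basic open sets eventually avoided by all stage points
      set 𝒰 : Set (Set (RootedHardCoreConfig E3 δ)) := {U ∈ B | ∀ᶠ j in atTop,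
        ∀ i : Fin (n (ψ j)), RootedHardCoreConfig.ofFinite (x (ψ j)) (hsepx (ψ j)) i ∉ U} with h𝒰
      have hsub : {S : RootedHardCoreConfig E3 δ | ¬ ∀ m : ℕ, ∃ᶠ j in atTop, ∃ i : Fin (n (ψ j)),
          dist (RootedHardCoreConfig.ofFinite (x (ψ j)) (hsepx (ψ j)) i) S < 1 / ((m : ℝ) + 1)} ⊆
          ⋃ U ∈ 𝒰, U := by
        intro S hS
        simp only [mem_setOf_eq, not_forall, not_frequently, not_exists, not_lt] at hS
        obtain ⟨m, hm⟩ := hS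
        have hball : ball S (1 / ((m : ℝ) + 1)) ∈ 𝓝 S := ball_mem_nhds S (by positivity)
        obtain ⟨U, hUB, hSU, hUball⟩ := hB.mem_nhds_iff.1 hball
        refine mem_iUnion₂.2 ⟨U, ⟨hUB, ?_⟩, hSU⟩
        filter_upwards [hm] with j hj i hiU
        have h := mem_ball.1 (hUball hiU)
        exact absurd h (not_lt.2 (hj i))
      refine measure_mono_null hsub ?_
      have h𝒰c : 𝒰.Countable := hBc.mono fun U hU => hU.1
      rw [measure_biUnion_null_iff h𝒰c]
      rintro U ⟨hUB, hUev⟩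
      have hUo : IsOpen U := hB.isOpen hUB
      have hle := ProbabilityMeasure.le_liminf_measure_open_of_tendsto hlim hUo
      have hzero : ∀ᶠ j in atTop,
          (((Qs ∘ ψ) j : ProbabilityMeasure (RootedHardCoreConfig E3 δ)) :
            Measure (RootedHardCoreConfig E3 δ)) U = 0 := by
        filter_upwards [hUev] with j hj
        change (((n (ψ j) : ℕ) : ℝ≥0∞)⁻¹ • ∑ i : Fin (n (ψ j)), (Measure.dirac (RootedHardCoreConfig.ofFinite (x (ψ j)) (hsepx (ψ j)) i) :
      Measure (RootedHardCoreConfig E3 δ))) U = 0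
        rw [emp_apply hUo.measurableSet]
        have hempty : (Finset.univ.filter fun i =>
            RootedHardCoreConfig.ofFinite (x (ψ j)) (hsepx (ψ j)) i ∈ U) = ∅ :=
          Finset.filter_eq_empty_iff.2 fun i _ => hj i
        rw [hempty, Finset.card_empty, Nat.cast_zero, mul_zero]
      have hlim0 : liminf (fun j => (((Qs ∘ ψ) j : ProbabilityMeasure (RootedHardCoreConfig E3 δ)) :
          Measure (RootedHardCoreConfig E3 δ)) U) atTop = 0 := by
        rw [liminf_congr hzero, liminf_const]
      rw [hlim0] at hle
      exact le_antisymm hle bot_le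
    rw [ae_iff]
    exact measure_mono_null (fun S hS hfreq => hS (key S hfreq)) hnull
  · -- the mean root energy
    rw [hE.integral_map]
    set H : RootedHardCoreConfig E3 δ →ᵇ ℝ := BoundedContinuousFunction.mkOfCompact
      ⟨fun S => (∫ y, lennardJones ‖y‖ ∂((S.1 : LocalConfig E3).toMeasure)) / 2,
        (continuous_integral_lennardJones_toMeasure hδ).div_const 2⟩ with hH_def
    have hlimH := (ProbabilityMeasure.tendsto_iff_forall_integral_tendsto.1 hlim) H
    refine (hlimH.congr fun j => ?_)
    change ∫ S, (∫ y, lennardJones ‖y‖ ∂((S.1 : LocalConfig E3).toMeasure)) / 2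
      ∂(((n (ψ j) : ℕ) : ℝ≥0∞)⁻¹ • ∑ i : Fin (n (ψ j)), (Measure.dirac (RootedHardCoreConfig.ofFinite (x (ψ j)) (hsepx (ψ j)) i) :
      Measure (RootedHardCoreConfig E3 δ))) = _
    rw [integral_rootEnergy_emp (hinj _)]
  · -- density transfer (portmanteau with open fattenings)
    intro T R ε hε ρ hρ
    by_cases hρ0 : ρ < 0
    · exact Eventually.of_forall fun j =>
        (mul_nonpos_of_nonpos_of_nonneg hρ0.le (Nat.cast_nonneg _)).trans (Nat.cast_nonneg _)
    rw [not_lt] at hρ0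
    -- the open fattening `O` of `e ⁻¹' T`
    set O : Set (RootedHardCoreConfig E3 δ) := {S | ∃ S₀ : RootedHardCoreConfig E3 δ, e S₀ ∈ T ∧
      ∃ R' ε', R < R' ∧ 0 ≤ ε' ∧ ε' < ε ∧
        LocallyMatches R' ε' ((S₀.1 : LocalConfig E3) : Set E3) ((S.1 : LocalConfig E3) : Set E3)}
      with hO_def
    have hO : IsOpen O := by
      have : O = ⋃ S₀ ∈ {S₀ : RootedHardCoreConfig E3 δ | e S₀ ∈ T},
          Subtype.val ⁻¹' {S : LocalConfig E3 | ∃ R' ε', R < R' ∧ 0 ≤ ε' ∧ ε' < ε ∧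
            LocallyMatches R' ε' ((S₀.1 : LocalConfig E3) : Set E3) (S : Set E3)} := by
        ext S
        simp only [hO_def, mem_setOf_eq, mem_iUnion, mem_preimage, exists_prop]
      rw [this]
      exact isOpen_biUnion fun S₀ _ =>
        (isOpen_setOf_locallyMatches _ R ε).preimage continuous_subtype_val
    have hTO : e ⁻¹' T ⊆ O := fun S hS =>
      ⟨S, hS, R + 1, ε / 2, by linarith, by linarith, by linarith, locallyMatches_self (by linarith) _ _⟩
    -- portmanteau
    have hPT : ((Q : Measure (RootedHardCoreConfig E3 δ)).map e) T ≤
        (Q : Measure (RootedHardCoreConfig E3 δ)) O := by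
      rw [hE.map_apply]
      exact measure_mono hTO
    have hρO : ENNReal.ofReal ρ < (Q : Measure (RootedHardCoreConfig E3 δ)) O := by
      rw [ENNReal.ofReal_lt_iff_lt_toReal hρ0 (measure_ne_top _ _)]
      exact hρ.trans_le (ENNReal.toReal_mono (measure_ne_top _ _) hPT)
    have hliminf := ProbabilityMeasure.le_liminf_measure_open_of_tendsto hlim hO
    have hev : ∀ᶠ j in atTop, ENNReal.ofReal ρ <
        (Qs (ψ j) : Measure (RootedHardCoreConfig E3 δ)) O :=
      eventually_lt_of_lt_liminf (hρO.trans_le hliminf)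
    filter_upwards [hev] with j hj
    -- counting
    change ENNReal.ofReal ρ < (((n (ψ j) : ℕ) : ℝ≥0∞)⁻¹ • ∑ i : Fin (n (ψ j)), (Measure.dirac (RootedHardCoreConfig.ofFinite (x (ψ j)) (hsepx (ψ j)) i) :
      Measure (RootedHardCoreConfig E3 δ))) O at hj
    rw [emp_apply hO.measurableSet, ENNReal.ofReal_lt_iff_lt_toReal hρ0
      (ENNReal.mul_ne_top (ENNReal.inv_ne_top.2 (Nat.cast_ne_zero.2 (NeZero.ne (n (ψ j)))))
        (ENNReal.natCast_ne_top _)),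
      ENNReal.toReal_mul, ENNReal.toReal_inv, ENNReal.toReal_natCast, ENNReal.toReal_natCast,
      inv_mul_eq_div,
      lt_div_iff₀ (Nat.cast_pos.2 (Nat.pos_of_ne_zero (NeZero.ne (n (ψ j)))))] at hj
    refine hj.le.trans ?_
    have hsub : ∀ i : Fin (n (ψ j)), RootedHardCoreConfig.ofFinite (x (ψ j)) (hsepx (ψ j)) i ∈ O →
        ∃ ν ∈ T, LocallyMatches R ε (Set.range fun k : Fin (n (ψ j)) => x (ψ j) k - x (ψ j) i)
          (atoms ν) := by
      rintro i ⟨S₀, hS₀T, R', ε', hR', -, hε', hm⟩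
      refine ⟨e S₀, hS₀T, ?_⟩
      rw [he_def]
      dsimp only
      rw [atoms_toMeasure]
      exact hm.symm.mono hR'.le hε'.le
    rw [Nat.card_eq_fintype_card, Fintype.card_subtype]
    exact_mod_cast Finset.card_le_card (Finset.monotone_filter_right _ fun i _ hi => hsub i hi)

/-- **Registered stub `stub_hardCoreBSLimit`** (= the planner's `HardCoreBSLimit` of line
`ekeland-surgery-parity`, with the nonemptiness hypothesis `1 ≤ n k`): the Benjamini–Schramm limit
of a separated family with the support clause (`exists_limit_separated_supported`). [folklore] -/
theorem stub_hardCoreBSLimit :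
    ∀ δ : ℝ, 0 < δ → ∀ (n : ℕ → ℕ) (x : (k : ℕ) → (Fin (n k) → E3)), (∀ k, 1 ≤ n k) →
    (∀ k (i j : Fin (n k)), i ≠ j → δ ≤ dist (x k i) (x k j)) →
    ∃ φ : ℕ → ℕ, StrictMono φ ∧ ∃ P : Measure (Measure E3),
      IsProbabilityMeasure P ∧ (∀ᵐ μ ∂P, IsRootedHardCore δ μ) ∧ IsPointStationaryLaw P ∧
      (∀ᵐ μ ∂P, ∃ ψ : ℕ → ℕ, StrictMono ψ ∧ ∃ i : (k : ℕ) → Fin (n (φ (ψ k))),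
        ∀ R ε : ℝ, 0 < ε → ∀ᶠ k : ℕ in atTop,
          LocallyMatches R ε
            (Set.range fun j : Fin (n (φ (ψ k))) => x (φ (ψ k)) j - x (φ (ψ k)) (i k)) (atoms μ)) ∧
      Tendsto (fun j : ℕ => interactionEnergy lennardJones (x (φ j)) / (n (φ j) : ℝ)) atTop
        (𝓝 (∫ μ, rootEnergy lennardJones μ ∂P)) ∧
      ∀ (T : Set (Measure E3)) (R' ε : ℝ), 0 < ε → ∀ ρ : ℝ, ρ < (P T).toReal →
        ∀ᶠ j : ℕ in atTop, ρ * (n (φ j) : ℝ) ≤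
          (Nat.card {i : Fin (n (φ j)) // ∃ ν ∈ T,
            LocallyMatches R' ε (Set.range fun k : Fin (n (φ j)) => x (φ j) k - x (φ j) i)
              (atoms ν)} : ℝ) := by
  intro δ hδ n x hn hsepx
  haveI : Fact (0 < δ) := ⟨hδ⟩
  haveI : ∀ k, NeZero (n k) := fun k => ⟨Nat.one_le_iff_ne_zero.1 (hn k)⟩
  exact exists_limit_separated_supported x hsepx

end Summit.AtomisticToContinuum.Crystallization.Theorems.EkelandBSLimitSupported

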